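import Literature.Probability.RandomPlanarGeometry.LoewnerImageStepJet
import Literature.Probability.RandomPlanarGeometry.RestrictionHullsRiemannProofs
import HarnessLib

/-!
# Canonical restriction data of a `*`-hull and the one-step estimates in canonical form

For a `*`-hull `B ∈ 𝒬*` the restriction map `Φ_B` exists and is unique
(`IsStarHull.exists_isRestrictionMap`, `IsRestrictionMap.unique`). To follow the hulls
`B_t = g_t(A) - W_t` of [LSW] §5 in time without transporting conformal equivalences along set
equalities, we package the data of `B` as plain functions of the SET `B`:

* `starRMap B h` — the chosen restriction map (`h : IsStarHull B`);
* `starMap B : ℂ → ℂ` — its Schwarz-reflected extension `E_B = hullExt Φ_B` (`id` if `B ∉ 𝒬*`);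
* `starShift B : ℂ` — the real constant `L_B = lim (E_B z - z)` (`0` if `B ∉ 𝒬*`);
* `starDeriv B : ℝ` — `d_B = Φ_B'(0) ∈ (0, 1]` (`1` if `B ∉ 𝒬*`);
* `starDrift B ρ₀ : ℂ → ℂ` — the drift `D_B` of `LoewnerImageStepResidue` (`0` if `B ∉ 𝒬*`),

so that `h_B := starMap B - starShift B` is the hydrodynamically normalized map `g_B` of the hull
(`hmap`), and restate the one-step estimates of `LoewnerImageStepResidue`/`…Jet` for the pair
(`B`, `B' = slidHull U B u`) in these terms: Lipschitz bounds in time for `h`, `h'`, `h''`, `h'''`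
and `d` (`norm_starStep_sub_le`, `norm_deriv_starStep_sub_le`, `abs_starDeriv_slidHull_sub_le`, …)
and the first-order expansions of `h' - h` and `(h' - h)'` with the drift (`…_sub_drift_le`).

## References

* G. F. Lawler, *Conformally Invariant Processes in the Plane* (2005), §4.6.1 Prop. 4.40–4.41
  [Lawler2005].
* G. F. Lawler, O. Schramm, W. Werner, *Conformal restriction: the chordal case* (2003), §5
  [LawlerSchrammWerner2003Restriction].
-/

noncomputable section

open Set Filter Metric Function
open _root_.Complex _root_.Topology _root_.Real
open UpperHalfPlane (upperHalfPlaneSet)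
open scoped NNReal

namespace Literature.Probability.RandomPlanarGeometry

/-! ### Canonical restriction data -/

/-- The chosen restriction map `Φ_B` of a `*`-hull. [cite: LawlerSchrammWerner2003Restriction, §2 p. 8 (Φ_A)] -/
def starRMap (B : Set ℂ) (h : IsStarHull B) : ConformalEquiv (upperHalfPlaneSet \ B) upperHalfPlaneSet :=
  Classical.choose h.exists_isRestrictionMap

/-- The chosen map is a restriction map. [folklore] -/
theorem isRestrictionMap_starRMap {B : Set ℂ} (h : IsStarHull B) : IsRestrictionMap B (starRMap B h) :=
  Classical.choose_spec h.exists_isRestrictionMap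

open Classical in
/-- The reflected extension `E_B` of `Φ_B` as a function of the set `B` (`id` off `𝒬*`).
[folklore] -/
def starMap (B : Set ℂ) : ℂ → ℂ :=
  if h : IsStarHull B then hullExt (starRMap B h) else id

open Classical in
/-- The constant `L_B = lim_{z → ∞} (E_B(z) - z)` (`0` off `𝒬*`). [folklore] -/
def starShift (B : Set ℂ) : ℂ :=
  if h : IsStarHull B then hullShift (starRMap B h) else 0

open Classical in
/-- The restriction derivative `d_B = Φ_B'(0)` (`1` off `𝒬*`).
[cite: LawlerSchrammWerner2003Restriction, §2 (2.4)] -/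
def starDeriv (B : Set ℂ) : ℝ :=
  if h : IsStarHull B then
    Classical.choose (IsStarHull.exists_hasRestrictionDeriv_holds h (isRestrictionMap_starRMap h))
  else 1

open Classical in
/-- The drift `D_B` of the first-order expansion (`LoewnerImageStepResidue.driftFun`), computed on
the circle `|ζ| = ρ₀/2` (`0` off `𝒬*`). [cite: Lawler2005, Prop. 4.40] -/
def starDrift (B : Set ℂ) (ρ₀ : ℝ) : ℂ → ℂ :=
  if h : IsStarHull B then Loewner.driftFun (starRMap B h) (starDeriv B) ρ₀ else 0

section Spec

variable {B : Set ℂ} (h : IsStarHull B)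
include h

/-- Unfolding of `starMap` on `𝒬*`. [folklore] -/
theorem starMap_eq : starMap B = hullExt (starRMap B h) := by rw [starMap, dif_pos h]

/-- Unfolding of `starShift` on `𝒬*`. [folklore] -/
theorem starShift_eq : starShift B = hullShift (starRMap B h) := by rw [starShift, dif_pos h]

/-- Unfolding of `starDrift` on `𝒬*`. [folklore] -/
theorem starDrift_eq (ρ₀ : ℝ) : starDrift B ρ₀ = Loewner.driftFun (starRMap B h) (starDeriv B) ρ₀ := by
  rw [starDrift, dif_pos h]

/-- `d_B ∈ (0, 1]` is the restriction derivative of the chosen map. [cite: LawlerSchrammWerner2003Restriction, §2 (2.4)] -/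
theorem starDeriv_spec : 0 < starDeriv B ∧ starDeriv B ≤ 1 ∧
    HasRestrictionDeriv B (starRMap B h) (starDeriv B) := by
  rw [starDeriv, dif_pos h]
  exact Classical.choose_spec (IsStarHull.exists_hasRestrictionDeriv_holds h (isRestrictionMap_starRMap h))

/-- Any restriction data of `B` has derivative `d_B` (uniqueness of `Φ_B`). [folklore] -/
theorem HasRestrictionDeriv.eq_starDeriv {Ψ : ConformalEquiv (upperHalfPlaneSet \ B) upperHalfPlaneSet}
    {e : ℝ} (hΨ : IsRestrictionMap B Ψ) (he : HasRestrictionDeriv B Ψ e) : e = starDeriv B := by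
  obtain ⟨-, -, hd⟩ := starDeriv_spec h
  have heq : EqOn Ψ (starRMap B h) (upperHalfPlaneSet \ B) :=
    IsRestrictionMap.unique h (isRestrictionMap_starRMap h) hΨ
  have he' : HasRestrictionDeriv B (starRMap B h) e :=
    he.congr' (eventually_nhdsWithin_of_forall fun z hz ↦ by rw [heq hz])
  exact he'.unique h hd

/-- `h_B = hmap Φ_B = E_B - L_B`. [folklore] -/
theorem hmap_starRMap (z : ℂ) : Loewner.hmap (starRMap B h) z = starMap B z - starShift B := by
  rw [Loewner.hmap, starMap_eq h, starShift_eq h]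

/-- `E_B(0) = 0`. [folklore] -/
theorem starMap_zero : starMap B 0 = 0 := by
  rw [starMap_eq h, hullExt_zero h (isRestrictionMap_starRMap h)]

/-- `E_B'(0) = d_B`. [cite: LawlerSchrammWerner2003Restriction, §2 (2.4)] -/
theorem deriv_starMap_zero : deriv (starMap B) 0 = starDeriv B := by
  rw [starMap_eq h, deriv_hullExt_zero h (isRestrictionMap_starRMap h) (starDeriv_spec h).2.2]

/-- `L_B` is real. [folklore] -/
theorem starShift_im : (starShift B).im = 0 := by
  rw [starShift_eq h, hullShift_im h.isBoundedHull (isRestrictionMap_starRMap h)]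

end Spec

/-! ### The one-step estimates in canonical form -/

namespace Loewner

variable {B : Set ℂ} {ρ₀ : ℝ} {U : ℝ≥0 → ℝ} {u : ℝ≥0} {S : ℝ}
variable (hB : IsStarHull B) (hU : Continuous U) (hU0 : U 0 = 0) (hu : 0 < u)
  (hS : ∀ v : ℝ≥0, v ≤ u → |U v| ≤ S) (hρ₀ : 0 < ρ₀) (hBρ : Disjoint (ball (0 : ℂ) (8 * ρ₀)) B)
  (hη : stepSize S u ≤ starDeriv B * ρ₀ / 1000)

/-- `hmapT Φ_{B'} c z = E_{B'}(z - c) - L_{B'} + c`. [folklore] -/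
theorem hmapT_starRMap {B' : Set ℂ} (h' : IsStarHull B') (c : ℝ) (z : ℂ) :
    hmapT (starRMap B' h') c z = starMap B' (z - c) - starShift B' + c := by
  rw [hmapT, starMap_eq h', starShift_eq h']

include hB hU hU0 hS hρ₀ hBρ hη in
/-- The smallness hypothesis implies `η ≤ ρ₀`, so the slid hull is a `*`-hull. [folklore] -/
theorem isStarHull_slidHull_canonical : stepSize S u ≤ ρ₀ ∧ IsStarHull (slidHull U B u) := by
  obtain ⟨hd0, hd1, -⟩ := starDeriv_spec hB
  have hη' : stepSize S u ≤ ρ₀ := by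
    refine hη.trans ?_
    rw [div_le_iff₀ (by norm_num : (0 : ℝ) < 1000)]
    nlinarith
  exact ⟨hη', isStarHull_slidHull_step hB hU hU0 hS hρ₀ hBρ hη'⟩

/-- **The step in canonical form**: `h_{B'}^{U_u} - h_B`, where `h_B = E_B - L_B` and
`h^{c}_{B'}(z) = E_{B'}(z - c) - L_{B'} + c` (`h_t - h_s` in the coordinates slid by `W_s`).
[cite: Lawler2005, Prop. 4.40] -/
def starStep (B : Set ℂ) (U : ℝ≥0 → ℝ) (u : ℝ≥0) (z : ℂ) : ℂ :=
  (starMap (slidHull U B u) (z - U u) - starShift (slidHull U B u) + U u) - (starMap B z - starShift B)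

include hB hU hU0 hu hS hρ₀ hBρ hη in
/-- **`|h' - h| ≤ 25u/ρ₀` on `|z| ≤ ρ₀`** (canonical form of `norm_hmapT_sub_hmap_le`).
[cite: Lawler2005, Prop. 4.40] -/
theorem norm_starStep_le {z : ℂ} (hz : ‖z‖ ≤ ρ₀) : ‖starStep B U u z‖ ≤ 25 * u / ρ₀ := by
  obtain ⟨-, hB'⟩ := isStarHull_slidHull_canonical hB hU hU0 hS hρ₀ hBρ hη
  have := norm_hmapT_sub_hmap_le hB (isRestrictionMap_starRMap hB) (starDeriv_spec hB).2.2 hU hU0 hu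
    hS hρ₀ hBρ hη (isRestrictionMap_starRMap hB') hz
  rwa [hmapT_starRMap hB', hmap_starRMap hB] at this

include hB hU hU0 hu hS hρ₀ hBρ hη in
/-- **`|(h' - h)'| ≤ 50u/ρ₀²` on `|z| ≤ ρ₀/2`**, with `(h' - h)'(z) = E_{B'}'(z - U_u) - E_B'(z)`.
[folklore] -/
theorem norm_deriv_starStep_le {z : ℂ} (hz : ‖z‖ ≤ ρ₀ / 2) :
    ‖deriv (starMap (slidHull U B u)) (z - U u) - deriv (starMap B) z‖ ≤ 50 * u / ρ₀ ^ 2 := by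
  obtain ⟨-, hB'⟩ := isStarHull_slidHull_canonical hB hU hU0 hS hρ₀ hBρ hη
  have := norm_deriv_hmapT_sub_hmap_le hB (isRestrictionMap_starRMap hB) (starDeriv_spec hB).2.2 hU
    hU0 hu hS hρ₀ hBρ hη (isRestrictionMap_starRMap hB') hz
  rwa [← starMap_eq hB', ← starMap_eq hB] at this

include hB hU hU0 hu hS hρ₀ hBρ hη in
/-- **`|d_{B'} - d_B| ≤ 50u/ρ₀² + 2η/ρ₀`** (the previous bound at `z = 0`:
`|E_{B'}'(-U_u) - d_B| ≤ 50u/ρ₀²`, and `|E_{B'}'(-U_u) - E_{B'}'(0)| ≤ (2/ρ₀)|U_u|` by the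
second-derivative bound `|E_{B'}''| ≤ 2/ρ₀` on `B(0, 2ρ₀)`): `t ↦ d_t` is continuous.
[cite: LawlerSchrammWerner2003Restriction, §5 (h_t'(W_t) continuous)] -/
theorem abs_starDeriv_slidHull_sub_le :
    |starDeriv (slidHull U B u) - starDeriv B| ≤ 50 * u / ρ₀ ^ 2 + 2 * stepSize S u / ρ₀ := by
  obtain ⟨hη1, hB'⟩ := isStarHull_slidHull_canonical hB hU hU0 hS hρ₀ hBρ hη
  have hΦ := isRestrictionMap_starRMap hB
  have hΦ' := isRestrictionMap_starRMap hB'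
  have hd := (starDeriv_spec hB).2.2
  have h0 := norm_deriv_starStep_le hB hU hU0 hu hS hρ₀ hBρ hη (z := 0) (by rw [norm_zero]; positivity)
  rw [zero_sub, deriv_starMap_zero hB] at h0
  -- `|E'(-U u) - E'(0)| ≤ (2/ρ₀) |U u|`
  obtain ⟨hsub, hdiff⟩ := ball_subset_symmDomain_slid hB hΦ hd hU hU0 hu hS hρ₀ hBρ hη hΦ'
  obtain ⟨-, -, hη0, hη1', -⟩ := stepSize_small hB hΦ hd hu hS hρ₀ hη
  have hUu : |U u| ≤ stepSize S u := by
    have := hS u le_rfl; rw [stepSize]; have := Real.sqrt_nonneg (u : ℝ); linarith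
  have hd' : DifferentiableOn ℂ (deriv (hullExt (starRMap _ hB'))) (ball (0 : ℂ) (6 * ρ₀)) :=
    ((hdiff.analyticOnNhd isOpen_ball).deriv).differentiableOn
  have hmvt : ‖deriv (hullExt (starRMap _ hB')) (-(U u : ℂ)) - deriv (hullExt (starRMap _ hB')) 0‖ ≤
      2 / ρ₀ * ‖(-(U u : ℂ)) - 0‖ := by
    refine (convex_ball (0 : ℂ) (2 * ρ₀)).norm_image_sub_le_of_norm_deriv_le (f := deriv (hullExt (starRMap _ hB')))
      (fun w hw ↦ hd'.differentiableAt (isOpen_ball.mem_nhds (ball_subset_ball (by linarith) hw)))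
      (fun w hw ↦ norm_deriv_deriv_hullExt_slid_le hB hΦ hd hU hU0 hu hS hρ₀ hBρ hη hΦ' hw)
      (mem_ball_self (by positivity)) ?_
    rw [mem_ball_zero_iff, norm_neg, norm_real, Real.norm_eq_abs]; linarith
  rw [sub_zero, norm_neg, norm_real, Real.norm_eq_abs] at hmvt
  have hE0 : deriv (hullExt (starRMap _ hB')) 0 = starDeriv (slidHull U B u) := by
    rw [← starMap_eq hB']; exact deriv_starMap_zero hB'
  rw [hE0, ← starMap_eq hB'] at hmvt
  -- combine
  have hreal : ‖((starDeriv (slidHull U B u) : ℝ) : ℂ) - (starDeriv B : ℂ)‖ =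
      |starDeriv (slidHull U B u) - starDeriv B| := by
    rw [← ofReal_sub, norm_real, Real.norm_eq_abs]
  rw [← hreal]
  calc ‖((starDeriv (slidHull U B u) : ℝ) : ℂ) - (starDeriv B : ℂ)‖
      ≤ ‖(starDeriv (slidHull U B u) : ℂ) - deriv (starMap (slidHull U B u)) (-(U u : ℂ))‖ +
          ‖deriv (starMap (slidHull U B u)) (-(U u : ℂ)) - starDeriv B‖ := norm_sub_le_norm_sub_add_norm_sub _ _ _
    _ ≤ 2 / ρ₀ * |U u| + 50 * u / ρ₀ ^ 2 := by
        gcongr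
        · rw [norm_sub_rev]; exact hmvt
    _ ≤ 50 * u / ρ₀ ^ 2 + 2 * stepSize S u / ρ₀ := by
        have : 2 / ρ₀ * |U u| ≤ 2 / ρ₀ * stepSize S u := mul_le_mul_of_nonneg_left hUu (by positivity)
        have h' : 2 / ρ₀ * stepSize S u = 2 * stepSize S u / ρ₀ := by ring
        linarith

include hB hU hU0 hu hS hρ₀ hBρ hη in
/-- **The first-order expansion in canonical form**: for `|z| ≤ ρ₀/4`,
`|h'(z) - h(z) - 2u D_B(z)| ≤ 25000 u (η ρ₀ + u)/(d_B ρ₀³)`. [cite: Lawler2005, Prop. 4.40] -/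
theorem norm_starStep_sub_drift_le {z : ℂ} (hz : ‖z‖ ≤ ρ₀ / 4) :
    ‖starStep B U u z - 2 * (u : ℂ) * starDrift B ρ₀ z‖ ≤
      25000 * u * (stepSize S u * ρ₀ + u) / (starDeriv B * ρ₀ ^ 3) := by
  obtain ⟨-, hB'⟩ := isStarHull_slidHull_canonical hB hU hU0 hS hρ₀ hBρ hη
  have := norm_hmapT_sub_hmap_sub_le hB (isRestrictionMap_starRMap hB) (starDeriv_spec hB).2.2 hU hU0
    hu hS hρ₀ hBρ hη (isRestrictionMap_starRMap hB') hz
  rwa [hmapT_starRMap hB', hmap_starRMap hB, ← starDrift_eq hB] at this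

include hB hρ₀ hBρ in
/-- `E_B = starMap B` is holomorphic on `B(0, 4ρ₀)`. [folklore] -/
theorem differentiableOn_starMap : DifferentiableOn ℂ (starMap B) (ball (0 : ℂ) (4 * ρ₀)) := by
  rw [starMap_eq hB]
  exact (differentiableOn_hmap hB (isRestrictionMap_starRMap hB) hρ₀ hBρ).2.1

include hB hU hU0 hu hS hρ₀ hBρ hη in
/-- `E_{B'} = starMap B'` is holomorphic on `B(0, 6ρ₀)`. [folklore] -/
theorem differentiableOn_starMap_slidHull :
    DifferentiableOn ℂ (starMap (slidHull U B u)) (ball (0 : ℂ) (6 * ρ₀)) := by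
  obtain ⟨-, hB'⟩ := isStarHull_slidHull_canonical hB hU hU0 hS hρ₀ hBρ hη
  rw [starMap_eq hB']
  exact (ball_subset_symmDomain_slid hB (isRestrictionMap_starRMap hB) (starDeriv_spec hB).2.2 hU hU0 hu
    hS hρ₀ hBρ hη (isRestrictionMap_starRMap hB')).2

include hB hu hS hρ₀ hη in
/-- `|U_u| ≤ η ≤ ρ₀/1000`. [folklore] -/
theorem abs_driver_le : |U u| ≤ stepSize S u ∧ stepSize S u ≤ ρ₀ / 1000 ∧ 0 < stepSize S u := by
  obtain ⟨-, -, hη0, hη1, -⟩ := stepSize_small hB (isRestrictionMap_starRMap hB) (starDeriv_spec hB).2.2 hu hS hρ₀ hη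
  have hUu : |U u| ≤ stepSize S u := by
    have := hS u le_rfl; rw [stepSize]; have := Real.sqrt_nonneg (u : ℝ); linarith
  exact ⟨hUu, hη1, hη0⟩

include hB hU hU0 hu hS hρ₀ hBρ hη in
/-- A Cauchy step for differences `w ↦ F'(w - U_u) - F(w)` of iterated derivatives: if
`Δ_k(w) = E_{B'}^{(k)}(w - U_u) - E_B^{(k)}(w)` is bounded by `M` on `B̄(0, 2r)` (`2r ≤ ρ₀`), then
`Δ_{k+1}` is bounded by `M/r` on `B̄(0, r)`. [folklore] -/
theorem norm_iterate_deriv_sub_le {k : ℕ} {r M : ℝ} (hr : 0 < r) (hr2 : 2 * r ≤ ρ₀)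
    (hM : ∀ w ∈ closedBall (0 : ℂ) (2 * r),
      ‖deriv^[k] (starMap (slidHull U B u)) (w - U u) - deriv^[k] (starMap B) w‖ ≤ M)
    {z : ℂ} (hz : ‖z‖ ≤ r) :
    ‖deriv^[k + 1] (starMap (slidHull U B u)) (z - U u) - deriv^[k + 1] (starMap B) z‖ ≤ M / r := by
  obtain ⟨hUu, hη1, hη0⟩ := abs_driver_le hB hu hS hρ₀ hη
  have hA := (differentiableOn_starMap hB hρ₀ hBρ).analyticOnNhd isOpen_ball
  have hA' := (differentiableOn_starMap_slidHull hB hU hU0 hu hS hρ₀ hBρ hη).analyticOnNhd isOpen_ball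
  -- the difference function and its derivative
  set G : ℂ → ℂ := fun w ↦ deriv^[k] (starMap (slidHull U B u)) (w - U u) - deriv^[k] (starMap B) w with hG
  have hshift : ∀ w ∈ ball (0 : ℂ) (2 * ρ₀), w - U u ∈ ball (0 : ℂ) (6 * ρ₀) := fun w hw ↦ by
    rw [mem_ball_zero_iff] at hw ⊢
    calc ‖w - U u‖ ≤ ‖w‖ + ‖((U u : ℝ) : ℂ)‖ := norm_sub_le _ _
      _ < 6 * ρ₀ := by rw [norm_real, Real.norm_eq_abs]; linarith
  have hGd : ∀ w ∈ ball (0 : ℂ) (2 * ρ₀), HasDerivAt G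
      (deriv^[k + 1] (starMap (slidHull U B u)) (w - U u) - deriv^[k + 1] (starMap B) w) w := by
    intro w hw
    have h1 : HasDerivAt (deriv^[k] (starMap (slidHull U B u)))
        (deriv^[k + 1] (starMap (slidHull U B u)) (w - U u)) (w - U u) := by
      rw [Function.iterate_succ_apply']
      exact ((hA'.iterated_deriv k) _ (hshift w hw)).differentiableAt.hasDerivAt
    have h2 : HasDerivAt (deriv^[k] (starMap B)) (deriv^[k + 1] (starMap B) w) w := by
      rw [Function.iterate_succ_apply']
      exact ((hA.iterated_deriv k) _ (ball_subset_ball (by linarith) hw)).differentiableAt.hasDerivAt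
    exact (h1.comp_sub_const w (U u : ℂ)).sub h2
  have hGdiff : DifferentiableOn ℂ G (ball (0 : ℂ) (2 * ρ₀)) := fun w hw ↦
    (hGd w hw).differentiableAt.differentiableWithinAt
  have := norm_deriv_le_of_forall_closedBall (F := G) (r := r) (r' := r) (M := M) hr (by linarith) hGdiff
    (fun w hw ↦ hM w (by simpa [two_mul] using hw)) (mem_closedBall_zero_iff.2 hz)
  rwa [(hGd z (mem_ball_zero_iff.2 (by linarith))).deriv] at this

include hB hU hU0 hu hS hρ₀ hBρ hη in
/-- **`|(h' - h)''| ≤ 200u/ρ₀³` on `|z| ≤ ρ₀/4` and `|(h' - h)⁽³⁾| ≤ 1600u/ρ₀⁴` on `|z| ≤ ρ₀/8`**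
(Cauchy estimates from `|(h' - h)'| ≤ 50u/ρ₀²` on `|z| ≤ ρ₀/2`): `t ↦ h_t''(x)`, `h_t⁽³⁾(x)` are
Lipschitz. [folklore] -/
theorem norm_deriv2_starStep_le :
    (∀ z : ℂ, ‖z‖ ≤ ρ₀ / 4 →
      ‖deriv (deriv (starMap (slidHull U B u))) (z - U u) - deriv (deriv (starMap B)) z‖ ≤ 200 * u / ρ₀ ^ 3) ∧
    (∀ z : ℂ, ‖z‖ ≤ ρ₀ / 8 →
      ‖deriv (deriv (deriv (starMap (slidHull U B u)))) (z - U u) - deriv (deriv (deriv (starMap B))) z‖ ≤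
        1600 * u / ρ₀ ^ 4) := by
  have h1 : ∀ w ∈ closedBall (0 : ℂ) (2 * (ρ₀ / 4)),
      ‖deriv^[1] (starMap (slidHull U B u)) (w - U u) - deriv^[1] (starMap B) w‖ ≤ 50 * u / ρ₀ ^ 2 :=
    fun w hw ↦ norm_deriv_starStep_le hB hU hU0 hu hS hρ₀ hBρ hη (by
      have := mem_closedBall_zero_iff.1 hw; linarith)
  have h2 : ∀ z : ℂ, ‖z‖ ≤ ρ₀ / 4 →
      ‖deriv^[2] (starMap (slidHull U B u)) (z - U u) - deriv^[2] (starMap B) z‖ ≤ 200 * u / ρ₀ ^ 3 := by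
    intro z hz
    have := norm_iterate_deriv_sub_le hB hU hU0 hu hS hρ₀ hBρ hη (k := 1) (r := ρ₀ / 4) (by positivity)
      (by linarith) h1 hz
    refine this.trans (le_of_eq ?_); field_simp; ring
  have h3 : ∀ z : ℂ, ‖z‖ ≤ ρ₀ / 8 →
      ‖deriv^[3] (starMap (slidHull U B u)) (z - U u) - deriv^[3] (starMap B) z‖ ≤ 1600 * u / ρ₀ ^ 4 := by
    intro z hz
    have := norm_iterate_deriv_sub_le hB hU hU0 hu hS hρ₀ hBρ hη (k := 2) (r := ρ₀ / 8) (by positivity)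
      (by linarith) (fun w hw ↦ h2 w (by have := mem_closedBall_zero_iff.1 hw; linarith)) hz
    refine this.trans (le_of_eq ?_); field_simp; ring
  exact ⟨fun z hz ↦ by simpa using h2 z hz, fun z hz ↦ by simpa using h3 z hz⟩

include hB hρ₀ hBρ in
/-- `D_B = starDrift B ρ₀` is holomorphic on `B(0, ρ₀/2)`. [folklore] -/
theorem differentiableOn_starDrift : DifferentiableOn ℂ (starDrift B ρ₀) (ball (0 : ℂ) (ρ₀ / 2)) := by
  rw [starDrift_eq hB]
  exact differentiableOn_driftFun hB (isRestrictionMap_starRMap hB) (starDeriv_spec hB).2.2 hρ₀ hBρ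

include hB hU hU0 hu hS hρ₀ hBρ hη in
/-- **The first-order expansion at derivative level**: for `|z| ≤ ρ₀/8`,
`|E_{B'}'(z - U_u) - E_B'(z) - 2u D_B'(z)| ≤ 200000 u (η ρ₀ + u)/(d_B ρ₀⁴)` (Cauchy estimate from
`norm_starStep_sub_drift_le`): the time derivative of `h_t'(x)` is `2 D_t'(x - W_t)`.
[cite: Lawler2005, Prop. 4.40 and (4.36)] -/
theorem norm_deriv_starStep_sub_drift_le {z : ℂ} (hz : ‖z‖ ≤ ρ₀ / 8) :
    ‖deriv (starMap (slidHull U B u)) (z - U u) - deriv (starMap B) z -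
        2 * (u : ℂ) * deriv (starDrift B ρ₀) z‖ ≤
      200000 * u * (stepSize S u * ρ₀ + u) / (starDeriv B * ρ₀ ^ 4) := by
  obtain ⟨hUu, hη1, hη0⟩ := abs_driver_le hB hu hS hρ₀ hη
  obtain ⟨hd0, -, -⟩ := starDeriv_spec hB
  obtain ⟨-, hB'⟩ := isStarHull_slidHull_canonical hB hU hU0 hS hρ₀ hBρ hη
  have hA := (differentiableOn_starMap hB hρ₀ hBρ).analyticOnNhd isOpen_ball
  have hA' := (differentiableOn_starMap_slidHull hB hU hU0 hu hS hρ₀ hBρ hη).analyticOnNhd isOpen_ball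
  have hDd := differentiableOn_starDrift hB hρ₀ hBρ
  set G : ℂ → ℂ := fun w ↦ starStep B U u w - 2 * (u : ℂ) * starDrift B ρ₀ w with hG
  have hGd : ∀ w ∈ ball (0 : ℂ) (ρ₀ / 2), HasDerivAt G
      (deriv (starMap (slidHull U B u)) (w - U u) - deriv (starMap B) w -
        2 * (u : ℂ) * deriv (starDrift B ρ₀) w) w := by
    intro w hw
    have hw4 : w ∈ ball (0 : ℂ) (4 * ρ₀) := ball_subset_ball (by linarith) hw
    have hw6 : w - U u ∈ ball (0 : ℂ) (6 * ρ₀) := by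
      rw [mem_ball_zero_iff] at hw ⊢
      calc ‖w - U u‖ ≤ ‖w‖ + ‖((U u : ℝ) : ℂ)‖ := norm_sub_le _ _
        _ < 6 * ρ₀ := by rw [norm_real, Real.norm_eq_abs]; linarith
    have h1 : HasDerivAt (fun y ↦ starMap (slidHull U B u) (y - U u))
        (deriv (starMap (slidHull U B u)) (w - U u)) w :=
      ((hA' _ hw6).differentiableAt.hasDerivAt).comp_sub_const w (U u : ℂ)
    have h2 : HasDerivAt (starMap B) (deriv (starMap B) w) w := (hA _ hw4).differentiableAt.hasDerivAt
    have h3 : HasDerivAt (starDrift B ρ₀) (deriv (starDrift B ρ₀) w) w :=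
      (hDd.differentiableAt (isOpen_ball.mem_nhds hw)).hasDerivAt
    have hstep : HasDerivAt (starStep B U u)
        (deriv (starMap (slidHull U B u)) (w - U u) - deriv (starMap B) w) w := by
      have := ((h1.sub_const (starShift (slidHull U B u))).add_const ((U u : ℝ) : ℂ)).sub
        (h2.sub_const (starShift B))
      have hfun : starStep B U u = fun y ↦ (starMap (slidHull U B u) (y - U u) - starShift (slidHull U B u) + U u) -
          (starMap B y - starShift B) := rfl
      rw [hfun]
      exact this
    exact hstep.sub (h3.const_mul _)
  have hGdiff : DifferentiableOn ℂ G (ball (0 : ℂ) (ρ₀ / 2)) := fun w hw ↦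
    (hGd w hw).differentiableAt.differentiableWithinAt
  have hM : ∀ w ∈ closedBall (0 : ℂ) (ρ₀ / 8 + ρ₀ / 8), ‖G w‖ ≤
      25000 * u * (stepSize S u * ρ₀ + u) / (starDeriv B * ρ₀ ^ 3) := fun w hw ↦
    norm_starStep_sub_drift_le hB hU hU0 hu hS hρ₀ hBρ hη (by have := mem_closedBall_zero_iff.1 hw; linarith)
  have := norm_deriv_le_of_forall_closedBall (F := G) (r := ρ₀ / 8) (r' := ρ₀ / 8) (by positivity) (by linarith)
    hGdiff hM (mem_closedBall_zero_iff.2 hz)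
  rw [(hGd z (mem_ball_zero_iff.2 (by linarith))).deriv] at this
  refine this.trans (le_of_eq ?_)
  field_simp
  ring

end Loewner

end Literature.Probability.RandomPlanarGeometry
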